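import Literature.NumberTheory.Automorphic.CMLocalNonsplitBorelTransport      -- ★ p833070 (B-p04): `localNonsplitEquiv_apply_apply`, torus ↔ torus
import Literature.NumberTheory.Automorphic.CMXiTorusCharSplitTorusDecay        -- ★ `unitModulusChar_lt_one_of_forall_v_lt_one`, `…_eq_one_of_forall_v_eq_one`
import Literature.NumberTheory.Automorphic.AnisotropicUnitaryGroupCompactOfPlace -- ★ `conjLocal_apply_eq_of_smul_eq`
import Literature.NumberTheory.Automorphic.ValuedFieldValuativeRelBridge       -- ★ `v_lt_one_iff_valuation_lt_one`, `v_le_iff_valuation_le`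
import HarnessLib

/-!
# An admissible torus element of `U(Φ₃)(L⁺_v)` (Casselman's `a ∈ A⁻ ∖ A(𝒪)`) is the diagonal ray `d(α, 1, (σ_w α)⁻¹)` with `σ_w α = α`,
# `0 < |α|_w < 1` in the one-place model at a non-split place (Rogawski 1990, §1.10; Casselman 1995, Thm. 4.4.6)

Topic `NumberTheory/Automorphic`; namespace `Literature.NumberTheory.Automorphic.UnitaryGroup`.  THEOREMS ONLY; no definition, no named fact,
no instance, no notation, no `sorry`.  Cell `hodgecm-mathlib`, F0∕P3, road N5 (#109 ★ `UnitaryGroup.U3SquareIntegrableExponents`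
[Casselman1995, Thm. 4.4.6]), the «⇒»-direction SOCKET of the CM assembly (R6, F0P3-p01 (g10) deal 2026-08-31T20:28:48Z).

THE POINT.  The letter N5 quantifies, at a non-split finite place `v` of `L⁺`, over torus elements `t ∈ T(L⁺_v) = (cmBorelTriple L 3 v).M`
(`t = d(t₀₀, t₁₁, σ(t₀₀)⁻¹)` over `∏_{w ∣ v} L_w`) subject to THREE conditions — `σ(t₀₀) = t₀₀` (★ `conjLocal`), `t₁₁ = 1`, and
`‖t₀₀‖ < 1` (★ `unitModulusChar`, print's `a ∈ A⁻ ∖ A_∅(𝒪)A_Δ`).  The structure theory of the road (Iwahori data ★ `iwahoriDatumU3`, shell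
disjointness ★ `EntryHeight.pairwise_disjoint_image_doubleCoset_pow`, volumes) is written in the ONE-PLACE MODEL `U(σ_w, Φ₃)(L_w)` reached by
★ `localNonsplitEquiv` (`e`, entries read at the unique `w ∣ v`), along a diagonal ray `diag(u)` ∕ `d(ϖ, 1, (σ_w ϖ)⁻¹)` with `0 < |ϖ|_w < 1`.
This file reads the three conditions in the model: with `α := (t₀₀)_w ∈ L_w` and `σ_w := galAdicCompletionMap c hw`,
* §1 `galAdicCompletionMap_torusEntry_apply_eq` (`σ_w α = α`), `torusEntry_apply_ne_zero` (`α ≠ 0`),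
  **`v_torusEntry_apply_lt_one`** (`Valued.v α < 1` ⇐ `‖t₀₀‖ < 1`: one place above `v`, ★ `unitModulusChar_eq_one_of_forall_v_eq_one` ∕
  ★ `unitModulusChar_lt_one_of_forall_v_lt_one` at `t₀₀⁻¹`, trichotomy), and the `ValuativeRel` spellings `valuation_torusEntry_apply_lt_one` ∕ `_ne_zero`;
* §2 **`coe_localNonsplitEquiv_eq_diagonal`**: `(e t : Matrix) = diagonal ![α, 1, (σ_w α)⁻¹]` (the `ha` binder of ★ R5c
  `EntryHeight.pairwise_disjoint_image_doubleCoset_pow` and of ★ `coe_pow_eq_diagonal`, with `ϖ := α`), via ★ `localNonsplitEquiv_apply_apply`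
  and the torus relation `σ(d₀) d₂ = 1` (★ `glDiagonal_mem_unitaryGroupOfForm_antidiagonal_iff`);
* §3 **`exists_glDiagonal_eq_localNonsplitEquiv`**: the same as `e t = diag(u)` for units `u = (α, 1, (σ_w α)⁻¹)` with the RATIO BOUND
  `∀ i < j, valuation L_w (u_i u_j⁻¹) ≤ valuation L_w α` (the `hs`∕`hu` binders of ★ `iwahoriDatumU3`, `q := valuation L_w α`, `0 ≠ q < 1`).
* §4 the CONVERSE socket (for the «⇐» half at `b = d(β, 1, β⁻¹)`, `β = ϖ σ_w ϖ`): a CM torus element `b` with model matrix `d(β, 1, (σ_w β)⁻¹)`,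
  `σ_w β = β`, `|β|_w < 1` satisfies the three N5 conditions (**`n5Conditions_of_coe_localNonsplitEquiv_eq_diagonal`** and its three parts),
  and such `b` EXISTS for every `β ≠ 0` (**`exists_torus_coe_localNonsplitEquiv_eq_diagonal`**).
HC_CM is proved only modulo the printed citations until rung 0 closes; this file is count-neutral (a socket, no letter).

## References
* [Rogawski1990] J. D. Rogawski, *Automorphic Representations of Unitary Groups in Three Variables*, Ann. of Math. Stud. 123 (1990), §1.10
  p. 9 (`M = {d(α, β, ᾱ⁻¹)}`), §12.2 p. 173.
* [Casselman1995] W. Casselman, *Introduction to the theory of admissible representations of `p`-adic reductive groups* (1995 notes), §1.4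
  (`A⁻`), Thm. 4.4.6 (b).
* [PlatonovRapinchuk1994] V. Platonov, A. Rapinchuk, *Algebraic Groups and Number Theory* (1994), §5.1 (the one-place model at a non-split `v`).
-/

set_option autoImplicit false

open scoped MatrixGroups Matrix WithZero NNReal
open Matrix ValuativeRel

namespace Literature.NumberTheory.Automorphic

namespace UnitaryGroup

section CM

open _root_.NumberField _root_.IsDedekindDomain

variable (L : Type) [Field L] [NumberField L] [IsCMField L] (v : HeightOneSpectrum (𝓞 ↥(maximalRealSubfield L)))
  (w : PlacesOver L v) (hw : IsCMField.complexConj L • w.1 = w.1)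

/-! ## §1 The parameter `α = (t₀₀)_w`: `σ_w`-fixed, non-zero, of valuation `< 1` -/

omit [IsCMField L] in
/-- A unit of `∏_{w′ ∣ v} L_{w′}` has non-zero `w`-component. [cite: PlatonovRapinchuk1994, §5.1] -/
theorem units_apply_ne_zero (u : (LocalRing L v)ˣ) : (u : LocalRing L v) w ≠ 0 := by
  intro h
  have h1 := congr_fun (congrArg (fun x : (LocalRing L v)ˣ => (x : LocalRing L v)) (mul_inv_cancel u)) w
  simp only [Units.val_mul, Pi.mul_apply, h, zero_mul, Units.val_one, Pi.one_apply] at h1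
  exact zero_ne_one h1

/-- `α = (t₀₀)_w ≠ 0` for `t ∈ T(L⁺_v)`. [cite: Rogawski1990, §1.10 p. 9] -/
theorem torusEntry_apply_ne_zero (t : ↥(cmBorelTriple L 3 v).M) :
    ((torusEntry (conjLocal L (IsCMField.complexConj L) v) (cmLocalForm L 3 v) 0 t : (LocalRing L v)ˣ) : LocalRing L v) w ≠ 0 :=
  units_apply_ne_zero L v w _

include hw in
/-- **`σ(t₀₀) = t₀₀` read at the unique `w ∣ v`: `σ_w α = α`** (★ `conjLocal_apply_eq_of_smul_eq`). [cite: PlatonovRapinchuk1994, §5.1] [cite: Rogawski1990, §1.10 p. 9] -/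
theorem galAdicCompletionMap_torusEntry_apply_eq (t : ↥(cmBorelTriple L 3 v).M)
    (hfix : conjLocal L (IsCMField.complexConj L) v
        ((torusEntry (conjLocal L (IsCMField.complexConj L) v) (cmLocalForm L 3 v) 0 t : (LocalRing L v)ˣ) : LocalRing L v) =
      ((torusEntry (conjLocal L (IsCMField.complexConj L) v) (cmLocalForm L 3 v) 0 t : (LocalRing L v)ˣ) : LocalRing L v)) :
    galAdicCompletionMap (L := L) (IsCMField.complexConj L) hw
        (((torusEntry (conjLocal L (IsCMField.complexConj L) v) (cmLocalForm L 3 v) 0 t : (LocalRing L v)ˣ) : LocalRing L v) w) =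
      ((torusEntry (conjLocal L (IsCMField.complexConj L) v) (cmLocalForm L 3 v) 0 t : (LocalRing L v)ˣ) : LocalRing L v) w := by
  have h := congr_fun hfix w
  rwa [conjLocal_apply_eq_of_smul_eq (IsCMField.complexConj L) (IsCMField.complexConj_ne_one L) v w hw] at h

include hw in
/-- **`‖t₀₀‖ < 1 ⇒ |α|_w < 1`** at a non-split place (ONE place above `v`): if `|α|_w = 1` then `‖t₀₀‖ = 1` (★
`unitModulusChar_eq_one_of_forall_v_eq_one`); if `|α|_w > 1` then `|α⁻¹|_w < 1`, so `‖t₀₀⁻¹‖ < 1` (★ `unitModulusChar_lt_one_of_forall_v_lt_one`)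
and `‖t₀₀‖ > 1`.  Print: `a ∈ A⁻ ∖ A(𝒪) ⇔ |α(a)| < 1`. [cite: Casselman1995, Thm. 4.4.6 (b), §1.4] [cite: Rogawski1990, §12.2 p. 173] -/
theorem v_units_apply_lt_one_of_unitModulusChar_lt_one (u : (LocalRing L v)ˣ) (hlt : unitModulusChar (LocalRing L v) u < 1) :
    Valued.v ((u : LocalRing L v) w) < 1 := by
  haveI : Subsingleton (PlacesOver L v) :=
    PlacesOver.subsingleton_of_smul_eq (IsCMField.complexConj L) (IsCMField.complexConj_ne_one L) w hw
  rcases lt_trichotomy (Valued.v ((u : LocalRing L v) w)) 1 with h | h | h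
  · exact h
  · exfalso
    have h1 : unitModulusChar (LocalRing L v) u = 1 :=
      unitModulusChar_eq_one_of_forall_v_eq_one L v u fun w' => by rw [Subsingleton.elim w' w]; exact h
    exact (lt_irrefl (1 : ℝ≥0)) (h1 ▸ hlt)
  · exfalso
    -- `|α⁻¹|_w < 1`
    have hprod : Valued.v (((u⁻¹ : (LocalRing L v)ˣ) : LocalRing L v) w) * Valued.v ((u : LocalRing L v) w) = 1 := by
      rw [← map_mul, ← Pi.mul_apply, ← Units.val_mul, inv_mul_cancel, Units.val_one, Pi.one_apply, map_one]
    have hinv : Valued.v (((u⁻¹ : (LocalRing L v)ˣ) : LocalRing L v) w) < 1 := by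
      by_contra hge
      rw [not_lt] at hge
      have hle := mul_le_mul_left hge (Valued.v ((u : LocalRing L v) w))
      rw [one_mul, hprod] at hle
      exact (not_lt.2 hle) h
    have h2 : unitModulusChar (LocalRing L v) u⁻¹ < 1 :=
      unitModulusChar_lt_one_of_forall_v_lt_one L v u⁻¹ fun w' => by rw [Subsingleton.elim w' w]; exact hinv
    -- `χ(u⁻¹) χ(u) = 1` with both factors `< 1`: impossible
    have hmul : unitModulusChar (LocalRing L v) u⁻¹ * unitModulusChar (LocalRing L v) u = 1 := by
      rw [← map_mul, inv_mul_cancel, map_one]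
    have : unitModulusChar (LocalRing L v) u⁻¹ * unitModulusChar (LocalRing L v) u < 1 :=
      mul_lt_one_of_nonneg_of_lt_one_left zero_le h2 hlt.le
    exact (lt_irrefl (1 : ℝ≥0)) (hmul ▸ this)

include hw in
/-- **`Valued.v α < 1`** for an N5-admissible torus element (`‖t₀₀‖ < 1`). [cite: Casselman1995, Thm. 4.4.6 (b)] [cite: Rogawski1990, §12.2 p. 173] -/
theorem v_torusEntry_apply_lt_one (t : ↥(cmBorelTriple L 3 v).M)
    (hlt : unitModulusChar (LocalRing L v) (torusEntry (conjLocal L (IsCMField.complexConj L) v) (cmLocalForm L 3 v) 0 t) < 1) :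
    Valued.v (((torusEntry (conjLocal L (IsCMField.complexConj L) v) (cmLocalForm L 3 v) 0 t : (LocalRing L v)ˣ) : LocalRing L v) w) < 1 :=
  v_units_apply_lt_one_of_unitModulusChar_lt_one L v w hw _ hlt

include hw in
/-- The `ValuativeRel` spelling (★ `iwahoriDatumU3`'s `q`): `valuation L_w α < 1` and `valuation L_w α ≠ 0`.
[cite: Casselman1995, Thm. 4.4.6 (b)] [cite: Rogawski1990, §12.2 p. 173] -/
theorem valuation_torusEntry_apply_lt_one_and_ne_zero (t : ↥(cmBorelTriple L 3 v).M)
    (hlt : unitModulusChar (LocalRing L v) (torusEntry (conjLocal L (IsCMField.complexConj L) v) (cmLocalForm L 3 v) 0 t) < 1) :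
    valuation (w.1.adicCompletion L)
        (((torusEntry (conjLocal L (IsCMField.complexConj L) v) (cmLocalForm L 3 v) 0 t : (LocalRing L v)ˣ) : LocalRing L v) w) < 1 ∧
      valuation (w.1.adicCompletion L)
        (((torusEntry (conjLocal L (IsCMField.complexConj L) v) (cmLocalForm L 3 v) 0 t : (LocalRing L v)ˣ) : LocalRing L v) w) ≠ 0 :=
  ⟨(v_lt_one_iff_valuation_lt_one _).1 (v_torusEntry_apply_lt_one L v w hw t hlt),
    (Valuation.ne_zero_iff _).2 (torusEntry_apply_ne_zero L v w t)⟩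

/-! ## §2 The model matrix of `t`: `e t = d(α, 1, (σ_w α)⁻¹)` -/

/-- The torus relation of `U(Φ₃)` read at `w`: for `t = diag(d) ∈ T(L⁺_v)`, `σ_w((d₀)_w) · (d₂)_w = 1` (★
`glDiagonal_mem_unitaryGroupOfForm_antidiagonal_iff` at `i = 2`, ★ `conjLocal_apply_eq_of_smul_eq`). [cite: Rogawski1990, §1.10 p. 9] -/
theorem galAdicCompletionMap_apply_mul_apply_eq_one (t : ↥(cmBorelTriple L 3 v).M) (d : Fin 3 → (LocalRing L v)ˣ)
    (hd : glDiagonal 3 (LocalRing L v) d =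
      ((t : ↥(unitaryGroupOfForm (conjLocal L (IsCMField.complexConj L) v) (cmLocalForm L 3 v))) : GL (Fin 3) (LocalRing L v))) :
    galAdicCompletionMap (L := L) (IsCMField.complexConj L) hw ((d 0 : LocalRing L v) w) * (d 2 : LocalRing L v) w = 1 := by
  have hmem : glDiagonal 3 (LocalRing L v) d ∈
      unitaryGroupOfForm (conjLocal L (IsCMField.complexConj L) v) ((StdForm.antidiagonal 3).over (LocalRing L v)) := by
    rw [hd, ← cmLocalForm_eq_over L 3 v]
    exact (t : ↥(unitaryGroupOfForm (conjLocal L (IsCMField.complexConj L) v) (cmLocalForm L 3 v))).2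
  have h2 := (glDiagonal_mem_unitaryGroupOfForm_antidiagonal_iff (conjLocal L (IsCMField.complexConj L) v) 3 d).1 hmem 2
  have hrev : Fin.rev (2 : Fin 3) = 0 := rfl
  rw [hrev] at h2
  have h := congr_fun h2 w
  rwa [Pi.mul_apply, Pi.one_apply, conjLocal_apply_eq_of_smul_eq (IsCMField.complexConj L) (IsCMField.complexConj_ne_one L) v w hw] at h

/-- **The model matrix of an N5-admissible torus element is the diagonal ray `d(α, 1, (σ_w α)⁻¹)`**, `α = (t₀₀)_w`: for `t ∈ T(L⁺_v)` with
`t₁₁ = 1`, `(e t)ᵢⱼ = (tᵢⱼ)_w` (★ `localNonsplitEquiv_apply_apply`), `t = diag(t₀₀, 1, σ(t₀₀)⁻¹)`.  This is the `ha` binder of ★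
`EntryHeight.pairwise_disjoint_image_doubleCoset_pow` ∕ ★ `coe_pow_eq_diagonal` with `ϖ := α` (no uniformiser needed).
[cite: Rogawski1990, §1.10 p. 9] [cite: PlatonovRapinchuk1994, §5.1] -/
theorem coe_localNonsplitEquiv_eq_diagonal (t : ↥(cmBorelTriple L 3 v).M)
    (h1 : torusEntry (conjLocal L (IsCMField.complexConj L) v) (cmLocalForm L 3 v) 1 t = 1) :
    (((localNonsplitEquiv (IsCMField.complexConj L) (Rogawski1990.qsForm L) (IsCMField.complexConj_ne_one L) w hw
          (t : ↥(unitaryGroupOfForm (conjLocal L (IsCMField.complexConj L) v) (cmLocalForm L 3 v))) :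
        ↥(unitaryGroupOfForm (galAdicCompletionMap (L := L) (IsCMField.complexConj L) hw) (placeForm (Rogawski1990.qsForm L) w.1))) :
          GL (Fin 3) (w.1.adicCompletion L)) : Matrix (Fin 3) (Fin 3) (w.1.adicCompletion L)) =
      Matrix.diagonal
        ![((torusEntry (conjLocal L (IsCMField.complexConj L) v) (cmLocalForm L 3 v) 0 t : (LocalRing L v)ˣ) : LocalRing L v) w, 1,
          (galAdicCompletionMap (L := L) (IsCMField.complexConj L) hw
            (((torusEntry (conjLocal L (IsCMField.complexConj L) v) (cmLocalForm L 3 v) 0 t : (LocalRing L v)ˣ) : LocalRing L v) w))⁻¹] := by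
  obtain ⟨d, hd⟩ := (mem_torusU_iff (σ := conjLocal L (IsCMField.complexConj L) v) (J := cmLocalForm L 3 v)
    (t : ↥(unitaryGroupOfForm (conjLocal L (IsCMField.complexConj L) v) (cmLocalForm L 3 v)))).1 t.2
  have hd0 : torusEntry (conjLocal L (IsCMField.complexConj L) v) (cmLocalForm L 3 v) 0 t = d 0 := torusEntry_eq_of_glDiagonal_eq _ _ 0 t d hd
  have hd1 : d 1 = 1 := by rw [← torusEntry_eq_of_glDiagonal_eq _ _ 1 t d hd, h1]
  have hrel := galAdicCompletionMap_apply_mul_apply_eq_one L v w hw t d hd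
  have hd2 : (d 2 : LocalRing L v) w =
      (galAdicCompletionMap (L := L) (IsCMField.complexConj L) hw ((d 0 : LocalRing L v) w))⁻¹ :=
    (eq_inv_of_mul_eq_one_right hrel)
  refine Matrix.ext fun i j => ?_
  rw [localNonsplitEquiv_apply_apply]
  have hmat : Units.val ((t : ↥(unitaryGroupOfForm (conjLocal L (IsCMField.complexConj L) v) (cmLocalForm L 3 v))) : GL (Fin 3) (LocalRing L v)) =
      Matrix.diagonal (fun k => (d k : LocalRing L v)) := by
    rw [← hd, coe_glDiagonal]
  rw [hmat, hd0]
  by_cases hij : i = j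
  · subst hij
    rw [Matrix.diagonal_apply_eq, Matrix.diagonal_apply_eq]
    fin_cases i
    · rfl
    · show (d 1 : LocalRing L v) w = 1
      rw [hd1]; rfl
    · show (d 2 : LocalRing L v) w = (galAdicCompletionMap (L := L) (IsCMField.complexConj L) hw ((d 0 : LocalRing L v) w))⁻¹
      exact hd2
  · rw [Matrix.diagonal_apply_ne _ hij, Matrix.diagonal_apply_ne _ hij, Pi.zero_apply]

/-! ## §3 The model element as `diag(u)` with the ratio bound of `iwahoriDatumU3` -/

include hw in
/-- **`e t = diag(u)` with `u = (α, 1, (σ_w α)⁻¹)` and the RATIO BOUND `∀ i < j, valuation L_w (u_i u_j⁻¹) ≤ valuation L_w α`** (for `σ_w α = α`,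
`0 < |α|_w < 1`: the three ratios are `α`, `α²`, `α`): the `hs`∕`hu` binders of ★ `iwahoriDatumU3` with `q := valuation L_w α`, and
`u 0 = α`, `u 1 = 1`, `u 2 = (σ_w α)⁻¹` on the nose. [cite: Rogawski1990, §1.10 p. 9] [cite: Casselman1995, Thm. 4.4.6 (b), Prop. 1.4.4] -/
theorem exists_glDiagonal_eq_localNonsplitEquiv (t : ↥(cmBorelTriple L 3 v).M)
    (hfix : conjLocal L (IsCMField.complexConj L) v
        ((torusEntry (conjLocal L (IsCMField.complexConj L) v) (cmLocalForm L 3 v) 0 t : (LocalRing L v)ˣ) : LocalRing L v) =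
      ((torusEntry (conjLocal L (IsCMField.complexConj L) v) (cmLocalForm L 3 v) 0 t : (LocalRing L v)ˣ) : LocalRing L v))
    (h1 : torusEntry (conjLocal L (IsCMField.complexConj L) v) (cmLocalForm L 3 v) 1 t = 1)
    (hlt : unitModulusChar (LocalRing L v) (torusEntry (conjLocal L (IsCMField.complexConj L) v) (cmLocalForm L 3 v) 0 t) < 1) :
    ∃ u : Fin 3 → (w.1.adicCompletion L)ˣ,
      ((localNonsplitEquiv (IsCMField.complexConj L) (Rogawski1990.qsForm L) (IsCMField.complexConj_ne_one L) w hw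
          (t : ↥(unitaryGroupOfForm (conjLocal L (IsCMField.complexConj L) v) (cmLocalForm L 3 v))) :
        ↥(unitaryGroupOfForm (galAdicCompletionMap (L := L) (IsCMField.complexConj L) hw) (placeForm (Rogawski1990.qsForm L) w.1))) :
          GL (Fin 3) (w.1.adicCompletion L)) = glDiagonal 3 (w.1.adicCompletion L) u ∧
      (u 0 : w.1.adicCompletion L) =
        ((torusEntry (conjLocal L (IsCMField.complexConj L) v) (cmLocalForm L 3 v) 0 t : (LocalRing L v)ˣ) : LocalRing L v) w ∧
      (u 1 : w.1.adicCompletion L) = 1 ∧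
      (u 2 : w.1.adicCompletion L) =
        (galAdicCompletionMap (L := L) (IsCMField.complexConj L) hw
          (((torusEntry (conjLocal L (IsCMField.complexConj L) v) (cmLocalForm L 3 v) 0 t : (LocalRing L v)ˣ) : LocalRing L v) w))⁻¹ ∧
      ∀ i j : Fin 3, i < j →
        valuation (w.1.adicCompletion L) ((u i : w.1.adicCompletion L) * ((u j : w.1.adicCompletion L))⁻¹) ≤
          valuation (w.1.adicCompletion L)
            (((torusEntry (conjLocal L (IsCMField.complexConj L) v) (cmLocalForm L 3 v) 0 t : (LocalRing L v)ˣ) : LocalRing L v) w) := by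
  set α : w.1.adicCompletion L :=
    ((torusEntry (conjLocal L (IsCMField.complexConj L) v) (cmLocalForm L 3 v) 0 t : (LocalRing L v)ˣ) : LocalRing L v) w with hα
  have hα0 : α ≠ 0 := torusEntry_apply_ne_zero L v w t
  have hσα : galAdicCompletionMap (L := L) (IsCMField.complexConj L) hw α = α := galAdicCompletionMap_torusEntry_apply_eq L v w hw t hfix
  have hv1 : valuation (w.1.adicCompletion L) α < 1 := (valuation_torusEntry_apply_lt_one_and_ne_zero L v w hw t hlt).1
  have hmat := coe_localNonsplitEquiv_eq_diagonal L v w hw t h1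
  rw [hσα] at hmat
  refine ⟨![Units.mk0 α hα0, 1, (Units.mk0 α hα0)⁻¹], ?_, rfl, rfl, by rw [hσα]; rfl, ?_⟩
  · apply Units.ext
    rw [hmat, coe_glDiagonal]
    refine Matrix.ext fun i j => ?_
    by_cases hij : i = j
    · subst hij
      rw [Matrix.diagonal_apply_eq, Matrix.diagonal_apply_eq]
      fin_cases i <;> rfl
    · rw [Matrix.diagonal_apply_ne _ hij, Matrix.diagonal_apply_ne _ hij]
  · intro i j hij
    have hle1 : valuation (w.1.adicCompletion L) α ≤ 1 := hv1.le
    fin_cases i <;> fin_cases j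
    all_goals (first | exact absurd hij (by decide) | skip)
    · -- (0,1): `α · 1⁻¹ = α`
      show valuation (w.1.adicCompletion L) (α * (1 : w.1.adicCompletion L)⁻¹) ≤ valuation (w.1.adicCompletion L) α
      rw [inv_one, mul_one]
    · -- (0,2): `α · (α⁻¹)⁻¹ = α · α`
      show valuation (w.1.adicCompletion L) (α * (α⁻¹)⁻¹) ≤ valuation (w.1.adicCompletion L) α
      rw [inv_inv, map_mul]
      exact mul_le_of_le_one_right' hle1
    · -- (1,2): `1 · (α⁻¹)⁻¹ = α`
      show valuation (w.1.adicCompletion L) ((1 : w.1.adicCompletion L) * (α⁻¹)⁻¹) ≤ valuation (w.1.adicCompletion L) α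
      rw [inv_inv, one_mul]

/-! ## §4 The converse socket: a model ray `d(β, 1, (σ_w β)⁻¹)` with `σ_w β = β`, `0 < |β|_w < 1` IS N5-admissible -/

/-- Reading the torus coordinates of `b ∈ T(L⁺_v)` off the model matrix `e b = d(β, 1, (σ_w β)⁻¹)`: `(b₀₀)_w = β` and `(b₁₁)_w = 1`
(★ `localNonsplitEquiv_apply_apply`, ★ `coe_torusEntry`). [cite: Rogawski1990, §1.10 p. 9] [cite: PlatonovRapinchuk1994, §5.1] -/
theorem torusEntry_apply_eq_of_coe_localNonsplitEquiv_eq_diagonal {β : w.1.adicCompletion L} (b : ↥(cmBorelTriple L 3 v).M)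
    (hb : (((localNonsplitEquiv (IsCMField.complexConj L) (Rogawski1990.qsForm L) (IsCMField.complexConj_ne_one L) w hw
          (b : ↥(unitaryGroupOfForm (conjLocal L (IsCMField.complexConj L) v) (cmLocalForm L 3 v))) :
        ↥(unitaryGroupOfForm (galAdicCompletionMap (L := L) (IsCMField.complexConj L) hw) (placeForm (Rogawski1990.qsForm L) w.1))) :
          GL (Fin 3) (w.1.adicCompletion L)) : Matrix (Fin 3) (Fin 3) (w.1.adicCompletion L)) =
      Matrix.diagonal ![β, 1, (galAdicCompletionMap (L := L) (IsCMField.complexConj L) hw β)⁻¹]) :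
    ((torusEntry (conjLocal L (IsCMField.complexConj L) v) (cmLocalForm L 3 v) 0 b : (LocalRing L v)ˣ) : LocalRing L v) w = β ∧
      ((torusEntry (conjLocal L (IsCMField.complexConj L) v) (cmLocalForm L 3 v) 1 b : (LocalRing L v)ˣ) : LocalRing L v) w = 1 := by
  have h00 := congr_fun (congr_fun hb 0) 0
  have h11 := congr_fun (congr_fun hb 1) 1
  rw [localNonsplitEquiv_apply_apply, Matrix.diagonal_apply_eq] at h00 h11
  refine ⟨?_, ?_⟩
  · rw [coe_torusEntry]; exact h00
  · rw [coe_torusEntry]; exact h11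

include hw in
/-- **Converse socket, condition 1: `σ(b₀₀) = b₀₀`** for `e b = d(β, 1, (σ_w β)⁻¹)` with `σ_w β = β` (one place above `v`, ★
`conjLocal_apply_eq_of_smul_eq`). [cite: Rogawski1990, §1.10 p. 9] [cite: PlatonovRapinchuk1994, §5.1] -/
theorem conjLocal_torusEntry_eq_of_coe_localNonsplitEquiv_eq_diagonal {β : w.1.adicCompletion L}
    (hσβ : galAdicCompletionMap (L := L) (IsCMField.complexConj L) hw β = β) (b : ↥(cmBorelTriple L 3 v).M)
    (hb : (((localNonsplitEquiv (IsCMField.complexConj L) (Rogawski1990.qsForm L) (IsCMField.complexConj_ne_one L) w hw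
          (b : ↥(unitaryGroupOfForm (conjLocal L (IsCMField.complexConj L) v) (cmLocalForm L 3 v))) :
        ↥(unitaryGroupOfForm (galAdicCompletionMap (L := L) (IsCMField.complexConj L) hw) (placeForm (Rogawski1990.qsForm L) w.1))) :
          GL (Fin 3) (w.1.adicCompletion L)) : Matrix (Fin 3) (Fin 3) (w.1.adicCompletion L)) =
      Matrix.diagonal ![β, 1, (galAdicCompletionMap (L := L) (IsCMField.complexConj L) hw β)⁻¹]) :
    conjLocal L (IsCMField.complexConj L) v
        ((torusEntry (conjLocal L (IsCMField.complexConj L) v) (cmLocalForm L 3 v) 0 b : (LocalRing L v)ˣ) : LocalRing L v) =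
      ((torusEntry (conjLocal L (IsCMField.complexConj L) v) (cmLocalForm L 3 v) 0 b : (LocalRing L v)ˣ) : LocalRing L v) := by
  haveI : Subsingleton (PlacesOver L v) :=
    PlacesOver.subsingleton_of_smul_eq (IsCMField.complexConj L) (IsCMField.complexConj_ne_one L) w hw
  have h0 := (torusEntry_apply_eq_of_coe_localNonsplitEquiv_eq_diagonal L v w hw b hb).1
  funext w'
  obtain rfl : w' = w := Subsingleton.elim _ _
  rw [conjLocal_apply_eq_of_smul_eq (IsCMField.complexConj L) (IsCMField.complexConj_ne_one L) v w' hw, h0, hσβ]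

include hw in
/-- **Converse socket, condition 2: `b₁₁ = 1`** for `e b = d(β, 1, (σ_w β)⁻¹)`. [cite: Rogawski1990, §1.10 p. 9] [cite: PlatonovRapinchuk1994, §5.1] -/
theorem torusEntry_one_eq_one_of_coe_localNonsplitEquiv_eq_diagonal {β : w.1.adicCompletion L} (b : ↥(cmBorelTriple L 3 v).M)
    (hb : (((localNonsplitEquiv (IsCMField.complexConj L) (Rogawski1990.qsForm L) (IsCMField.complexConj_ne_one L) w hw
          (b : ↥(unitaryGroupOfForm (conjLocal L (IsCMField.complexConj L) v) (cmLocalForm L 3 v))) :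
        ↥(unitaryGroupOfForm (galAdicCompletionMap (L := L) (IsCMField.complexConj L) hw) (placeForm (Rogawski1990.qsForm L) w.1))) :
          GL (Fin 3) (w.1.adicCompletion L)) : Matrix (Fin 3) (Fin 3) (w.1.adicCompletion L)) =
      Matrix.diagonal ![β, 1, (galAdicCompletionMap (L := L) (IsCMField.complexConj L) hw β)⁻¹]) :
    torusEntry (conjLocal L (IsCMField.complexConj L) v) (cmLocalForm L 3 v) 1 b = 1 := by
  haveI : Subsingleton (PlacesOver L v) :=
    PlacesOver.subsingleton_of_smul_eq (IsCMField.complexConj L) (IsCMField.complexConj_ne_one L) w hw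
  have h1 := (torusEntry_apply_eq_of_coe_localNonsplitEquiv_eq_diagonal L v w hw b hb).2
  apply Units.ext
  funext w'
  obtain rfl : w' = w := Subsingleton.elim _ _
  rw [h1, Units.val_one, Pi.one_apply]

include hw in
/-- **Converse socket, condition 3: `‖b₀₀‖ < 1`** for `e b = d(β, 1, (σ_w β)⁻¹)` with `|β|_w < 1` (★ `unitModulusChar_lt_one_of_forall_v_lt_one`,
one place above `v`). [cite: Casselman1995, Thm. 4.4.6 (b), §1.4] [cite: Rogawski1990, §12.2 p. 173] -/
theorem unitModulusChar_torusEntry_lt_one_of_coe_localNonsplitEquiv_eq_diagonal {β : w.1.adicCompletion L} (hβ1 : Valued.v β < 1)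
    (b : ↥(cmBorelTriple L 3 v).M)
    (hb : (((localNonsplitEquiv (IsCMField.complexConj L) (Rogawski1990.qsForm L) (IsCMField.complexConj_ne_one L) w hw
          (b : ↥(unitaryGroupOfForm (conjLocal L (IsCMField.complexConj L) v) (cmLocalForm L 3 v))) :
        ↥(unitaryGroupOfForm (galAdicCompletionMap (L := L) (IsCMField.complexConj L) hw) (placeForm (Rogawski1990.qsForm L) w.1))) :
          GL (Fin 3) (w.1.adicCompletion L)) : Matrix (Fin 3) (Fin 3) (w.1.adicCompletion L)) =
      Matrix.diagonal ![β, 1, (galAdicCompletionMap (L := L) (IsCMField.complexConj L) hw β)⁻¹]) :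
    unitModulusChar (LocalRing L v) (torusEntry (conjLocal L (IsCMField.complexConj L) v) (cmLocalForm L 3 v) 0 b) < 1 := by
  haveI : Subsingleton (PlacesOver L v) :=
    PlacesOver.subsingleton_of_smul_eq (IsCMField.complexConj L) (IsCMField.complexConj_ne_one L) w hw
  have h0 := (torusEntry_apply_eq_of_coe_localNonsplitEquiv_eq_diagonal L v w hw b hb).1
  refine unitModulusChar_lt_one_of_forall_v_lt_one L v _ fun w' => ?_
  obtain rfl : w' = w := Subsingleton.elim _ _
  rw [h0]; exact hβ1

include hw in
/-- **THE CONVERSE SOCKET**: a CM torus element `b` whose model matrix is `d(β, 1, (σ_w β)⁻¹)` with `σ_w β = β`, `|β|_w < 1` satisfies N5's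
three conditions (`σ(b₀₀) = b₀₀`, `b₁₁ = 1`, `‖b₀₀‖ < 1`) — used by the «⇐» half of R6 at `β := ϖ · σ_w ϖ`.
[cite: Casselman1995, Thm. 4.4.6 (b)] [cite: Rogawski1990, §1.10 p. 9; §12.2 p. 173] -/
theorem n5Conditions_of_coe_localNonsplitEquiv_eq_diagonal {β : w.1.adicCompletion L}
    (hσβ : galAdicCompletionMap (L := L) (IsCMField.complexConj L) hw β = β) (hβ1 : Valued.v β < 1) (b : ↥(cmBorelTriple L 3 v).M)
    (hb : (((localNonsplitEquiv (IsCMField.complexConj L) (Rogawski1990.qsForm L) (IsCMField.complexConj_ne_one L) w hw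
          (b : ↥(unitaryGroupOfForm (conjLocal L (IsCMField.complexConj L) v) (cmLocalForm L 3 v))) :
        ↥(unitaryGroupOfForm (galAdicCompletionMap (L := L) (IsCMField.complexConj L) hw) (placeForm (Rogawski1990.qsForm L) w.1))) :
          GL (Fin 3) (w.1.adicCompletion L)) : Matrix (Fin 3) (Fin 3) (w.1.adicCompletion L)) =
      Matrix.diagonal ![β, 1, (galAdicCompletionMap (L := L) (IsCMField.complexConj L) hw β)⁻¹]) :
    conjLocal L (IsCMField.complexConj L) v
          ((torusEntry (conjLocal L (IsCMField.complexConj L) v) (cmLocalForm L 3 v) 0 b : (LocalRing L v)ˣ) : LocalRing L v) =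
        ((torusEntry (conjLocal L (IsCMField.complexConj L) v) (cmLocalForm L 3 v) 0 b : (LocalRing L v)ˣ) : LocalRing L v) ∧
      torusEntry (conjLocal L (IsCMField.complexConj L) v) (cmLocalForm L 3 v) 1 b = 1 ∧
      unitModulusChar (LocalRing L v) (torusEntry (conjLocal L (IsCMField.complexConj L) v) (cmLocalForm L 3 v) 0 b) < 1 :=
  ⟨conjLocal_torusEntry_eq_of_coe_localNonsplitEquiv_eq_diagonal L v w hw hσβ b hb,
    torusEntry_one_eq_one_of_coe_localNonsplitEquiv_eq_diagonal L v w hw b hb,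
    unitModulusChar_torusEntry_lt_one_of_coe_localNonsplitEquiv_eq_diagonal L v w hw hβ1 b hb⟩

/-- **Existence of the ray in `T(L⁺_v)`**: for `β ≠ 0` in `L_w` there is a CM torus element `b ∈ (cmBorelTriple L 3 v).M` whose model matrix is
`d(β, 1, (σ_w β)⁻¹)` (★ `exists_coe_eq_diagonal_uniformizer` in the model — `β` need not be a uniformiser — pulled back along `e.symm`, torus
membership by ★ `localNonsplitEquiv_mem_torusU_iff`). [cite: Rogawski1990, §1.10 p. 9] [cite: PlatonovRapinchuk1994, §5.1] -/
theorem exists_torus_coe_localNonsplitEquiv_eq_diagonal {β : w.1.adicCompletion L} (hβ0 : β ≠ 0) :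
    ∃ b : ↥(cmBorelTriple L 3 v).M,
      (((localNonsplitEquiv (IsCMField.complexConj L) (Rogawski1990.qsForm L) (IsCMField.complexConj_ne_one L) w hw
          (b : ↥(unitaryGroupOfForm (conjLocal L (IsCMField.complexConj L) v) (cmLocalForm L 3 v))) :
        ↥(unitaryGroupOfForm (galAdicCompletionMap (L := L) (IsCMField.complexConj L) hw) (placeForm (Rogawski1990.qsForm L) w.1))) :
          GL (Fin 3) (w.1.adicCompletion L)) : Matrix (Fin 3) (Fin 3) (w.1.adicCompletion L)) =
      Matrix.diagonal ![β, 1, (galAdicCompletionMap (L := L) (IsCMField.complexConj L) hw β)⁻¹] := by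
  have hJw : placeForm (Rogawski1990.qsForm L) w.1 = (StdForm.antidiagonal 3).over (w.1.adicCompletion L) := by
    rw [placeForm, Rogawski1990.qsForm, antidiagOne_eq_over, StdForm.over_map]
  have hσσ : ∀ x, (galAdicCompletionMap (L := L) (IsCMField.complexConj L) hw)
      ((galAdicCompletionMap (L := L) (IsCMField.complexConj L) hw) x) = x :=
    galAdicCompletionMap_galAdicCompletionMap_of_smul_eq (IsCMField.complexConj L) w (IsCMField.complexConj_ne_one L) hw
  obtain ⟨a, ha⟩ := exists_coe_eq_diagonal_uniformizer (galAdicCompletionMap (L := L) (IsCMField.complexConj L) hw) hJw hσσ hβ0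
  have haT := mem_torusU_of_coe_eq_diagonal (galAdicCompletionMap (L := L) (IsCMField.complexConj L) hw) hJw hσσ hβ0 a ha
  set e := localNonsplitEquiv (IsCMField.complexConj L) (Rogawski1990.qsForm L) (IsCMField.complexConj_ne_one L) w hw with he
  have hmem : e.symm a ∈ (cmBorelTriple L 3 v).M := by
    rw [← localNonsplitEquiv_mem_torusU_iff L v w hw, ← he, ContinuousMulEquiv.apply_symm_apply]
    exact haT
  refine ⟨⟨e.symm a, hmem⟩, ?_⟩
  change (((e (e.symm a)) : GL (Fin 3) (w.1.adicCompletion L)) : Matrix (Fin 3) (Fin 3) (w.1.adicCompletion L)) = _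
  rw [ContinuousMulEquiv.apply_symm_apply, ha]

end CM

end UnitaryGroup

end Literature.NumberTheory.Automorphic
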